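import Literature.NumberTheory.Automorphic.IwahoriUpCrossPlace
import Literature.NumberTheory.Automorphic.LevelActionNormalizingHecke
import HarnessLib

/-!
# Multiplicativity of Hecke operators in the coefficients-at-`p` model; `U_p`-operators multiply

Topic `NumberTheory/Automorphic`; namespace `Literature.NumberTheory.Automorphic.LevelAction`;
theorems only (universe `0`).  The `LevelAction` (coefficients carried by the level) analogue of
`IwahoriUpMultiplicative` / `IwahoriUpCrossPlace` ([ShimuraIATAF1971, Ch. 3, Prop. 3.3];
[KhareThorne2017, §6.2, §6.4]; [Hida1994AIF, §2]):

* **`heckeOp_heckeOp_apply`** — generic criterion `[UαU] ([UβU] m) = [U αβ U] m` on `m ∈ M^U`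
  (same combinatorial hypotheses `hmul`, `hinj` as `ArithmeticQuotient.heckeFun_comp_heckeFun`),
  with the `Rep` / cohomology versions `heckeRepHom_comp_heckeRepHom`, **`heckeCohomology_mul_eq`**;
* for the Hida levels `U(b',c)` of a tame level maximal above `p` and `v ∣ p`:
  **`heckeCohomology_level_heckeElement_pow_mul`** (`T(t_v^a) T(t_v^b) = T(t_v^{a+b})`, `a + b ≤ c`),
  **`heckeCohomology_level_heckeElement_pow`** (`T(t_v^r) = T(t_v)^r`, `r ≤ c`),
  **`heckeCohomology_level_mul_heckeElement_pow`** (`T(g) T(t_w^b) = T(g t_w^b)` for `g` trivial at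
  `w`), **`heckeCohomology_level_upElement_insert`** (`T(∏_{v ∈ s ∪ {w}} t_v^r) = T(∏_{v∈s} t_v^r) T(t_w^r)`).

## References

* G. Shimura, *Introduction to the Arithmetic Theory of Automorphic Functions* (1971), Ch. 3, Prop. 3.3. [ShimuraIATAF1971]
* C. Khare, J. A. Thorne, Amer. J. Math. 139 (2017), §6.2, §6.4 (arXiv:1409.7007, held). [KhareThorne2017]
* H. Hida, Ann. Inst. Fourier 44 (1994), §2 (held). [Hida1994AIF]
-/

noncomputable section

open CategoryTheory IsDedekindDomain NumberField

namespace Literature.NumberTheory.Automorphic.LevelAction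

/-! ### Generic criterion -/

section Abstract

variable {R : Type} [CommRing R] {𝒢 : Type} [Group 𝒢] {M : Type} [AddCommGroup M]
  [Module R M] {Δ : Submonoid 𝒢} {θ : Δ →* Module.End R M} {U : Subgroup 𝒢}

/-- **`[UαU] ([UβU] m) = [U αβ U] m` on `m ∈ M^U`** as soon as `α U β ⊆ U αβ U` (`hmul`) and
`(y, e) ↦ y • e` separates the cosets `yU` (`hinj`): then `(d, e) ↦ d̃ • e` is a bijection
`UαU/U × UβU/U ≃ UαβU/U`. [cite: ShimuraIATAF1971, Ch. 3, Prop. 3.3] -/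
theorem heckeOp_heckeOp_apply (hU : U.toSubmonoid ≤ Δ) {α β : 𝒢} (hα : α ∈ Δ) (hβ : β ∈ Δ)
    (hfin : (ArithmeticQuotient.doubleCosetQuot U α).Finite)
    (hfin' : (ArithmeticQuotient.doubleCosetQuot U β).Finite)
    (hfin'' : (ArithmeticQuotient.doubleCosetQuot U (α * β)).Finite)
    (hmul : ∀ l ∈ U, ((α * l * β : 𝒢) : 𝒢 ⧸ U) ∈ ArithmeticQuotient.doubleCosetQuot U (α * β))
    (hinj : ∀ y y' : 𝒢, (y : 𝒢 ⧸ U) ∈ ArithmeticQuotient.doubleCosetQuot U α →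
      (y' : 𝒢 ⧸ U) ∈ ArithmeticQuotient.doubleCosetQuot U α →
      ∀ e ∈ ArithmeticQuotient.doubleCosetQuot U β, ∀ e' ∈ ArithmeticQuotient.doubleCosetQuot U β,
        y • e = y' • e' → (y : 𝒢 ⧸ U) = (y' : 𝒢 ⧸ U))
    {m : M} (hm : m ∈ invariants Δ θ U) :
    heckeOp Δ θ U α (heckeOp Δ θ U β m) = heckeOp Δ θ U (α * β) m := by
  classical
  rw [heckeOp_eq_sum hfin, heckeOp_eq_sum hfin', heckeOp_eq_sum hfin'', LinearMap.sum_apply,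
    LinearMap.sum_apply, LinearMap.sum_apply]
  have hd : ∀ d ∈ hfin.toFinset, act Δ θ d.out (∑ e ∈ hfin'.toFinset, act Δ θ e.out m) =
      ∑ e ∈ hfin'.toFinset, act Δ θ (d.out • e).out m := by
    intro d hd
    rw [map_sum]
    refine Finset.sum_congr rfl fun e he => ?_
    rw [Set.Finite.mem_toFinset] at hd he
    have hdΔ : d.out ∈ Δ := out_mem_of_mem_doubleCosetQuot hU hα hd
    have heΔ : e.out ∈ Δ := out_mem_of_mem_doubleCosetQuot hU hβ he
    rw [← Module.End.mul_apply, ← act_mul hdΔ heΔ]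
    refine (act_out_apply_eq hU hm (Δ.mul_mem hdΔ heΔ) _ ?_).symm
    conv_rhs => rw [← QuotientGroup.out_eq' e]
    rfl
  rw [Finset.sum_congr rfl hd, ← Finset.sum_product']
  -- re-index along `(d, e) ↦ d.out • e`
  refine Finset.sum_bij (fun q _ => q.1.out • q.2) (fun q hq => ?_) (fun q hq q' hq' he => ?_)
    (fun c hc => ?_) (fun q _ => rfl)
  · rw [Finset.mem_product, Set.Finite.mem_toFinset, Set.Finite.mem_toFinset] at hq
    rw [Set.Finite.mem_toFinset]
    obtain ⟨l, hl, hld⟩ := ArithmeticQuotient.exists_coe_mul_eq_of_mem_doubleCosetQuot U hq.1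
    obtain ⟨u, hu⟩ := QuotientGroup.mk_out_eq_mul U (l * α)
    obtain ⟨l', hl', hle⟩ := ArithmeticQuotient.exists_coe_mul_eq_of_mem_doubleCosetQuot U hq.2
    have hout : q.1.out = l * α * u := by rw [← hu, hld]
    rw [hout, ← hle]
    have : ((l * α * u : 𝒢) • ((l' * β : 𝒢) : 𝒢 ⧸ U)) =
        (⟨l, hl⟩ : U) • (((α * (u * l') * β : 𝒢)) : 𝒢 ⧸ U) := by
      rw [MulAction.Quotient.smul_coe, smul_eq_mul]
      change _ = (((l : 𝒢) • ((α * (u * l') * β : 𝒢) : 𝒢 ⧸ U)))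
      rw [MulAction.Quotient.smul_coe, smul_eq_mul]
      congr 1
      group
    rw [this]
    exact ArithmeticQuotient.coe_smul_mem_doubleCosetQuot (hmul _ (U.mul_mem u.2 hl')) ⟨l, hl⟩
  · rw [Finset.mem_product, Set.Finite.mem_toFinset, Set.Finite.mem_toFinset] at hq hq'
    have h1 : (q.1.out : 𝒢 ⧸ U) = (q'.1.out : 𝒢 ⧸ U) :=
      hinj _ _ (by rw [QuotientGroup.out_eq']; exact hq.1) (by rw [QuotientGroup.out_eq']; exact hq'.1)
        _ hq.2 _ hq'.2 he
    rw [QuotientGroup.out_eq', QuotientGroup.out_eq'] at h1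
    have h2 : q.2 = q'.2 := by
      have he' : q.1.out • q.2 = q.1.out • q'.2 := by
        have h := he
        rwa [show q'.1 = q.1 from h1.symm] at h
      exact (smul_left_cancel_iff _).1 he'
    exact Prod.ext h1 h2
  · rw [Set.Finite.mem_toFinset] at hc
    obtain ⟨l, hl, hlc⟩ := ArithmeticQuotient.exists_coe_mul_eq_of_mem_doubleCosetQuot U hc
    obtain ⟨u, hu⟩ := QuotientGroup.mk_out_eq_mul U (l * α)
    refine ⟨(((l * α : 𝒢) : 𝒢 ⧸ U), (((u : 𝒢)⁻¹ * β : 𝒢) : 𝒢 ⧸ U)), ?_, ?_⟩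
    · rw [Finset.mem_product, Set.Finite.mem_toFinset, Set.Finite.mem_toFinset]
      exact ⟨⟨⟨l, hl⟩, rfl⟩, ⟨⟨(u : 𝒢)⁻¹, U.inv_mem u.2⟩, rfl⟩⟩
    · change (((l * α : 𝒢) : 𝒢 ⧸ U)).out • ((((u : 𝒢)⁻¹ * β : 𝒢)) : 𝒢 ⧸ U) = c
      rw [hu, MulAction.Quotient.smul_coe, smul_eq_mul, ← hlc]
      congr 1
      group

end Abstract

/-! ### On cohomology -/

section Cohomology

variable {R : Type} [CommRing R] {Γ 𝒢 : Type} [Group Γ] [Group 𝒢] (ι : Γ →* 𝒢) (Δ : Submonoid 𝒢)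
  {V : Type} [AddCommGroup V] [Module R V] (τ : Δ →* Module.End R V) (U : Subgroup 𝒢)
  (hU : U.toSubmonoid ≤ Δ)

/-- **`[UβU] ≫ [UαU] = [UγU]` as `Rep`-morphisms** (`γ = αβ`; criterion `heckeOp_heckeOp_apply`).
[cite: ShimuraIATAF1971, Ch. 3, Prop. 3.3] -/
theorem heckeRepHom_comp_heckeRepHom {α β γ : 𝒢} (hα : α ∈ Δ) (hβ : β ∈ Δ) (hγ : γ ∈ Δ) (hαβ : α * β = γ)
    (hfin : (ArithmeticQuotient.doubleCosetQuot U α).Finite)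
    (hfin' : (ArithmeticQuotient.doubleCosetQuot U β).Finite)
    (hfin'' : (ArithmeticQuotient.doubleCosetQuot U (α * β)).Finite)
    (hmul : ∀ l ∈ U, ((α * l * β : 𝒢) : 𝒢 ⧸ U) ∈ ArithmeticQuotient.doubleCosetQuot U (α * β))
    (hinj : ∀ y y' : 𝒢, (y : 𝒢 ⧸ U) ∈ ArithmeticQuotient.doubleCosetQuot U α →
      (y' : 𝒢 ⧸ U) ∈ ArithmeticQuotient.doubleCosetQuot U α →
      ∀ e ∈ ArithmeticQuotient.doubleCosetQuot U β, ∀ e' ∈ ArithmeticQuotient.doubleCosetQuot U β,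
        y • e = y' • e' → (y : 𝒢 ⧸ U) = (y' : 𝒢 ⧸ U)) :
    heckeRepHom ι Δ τ U hU hβ ≫ heckeRepHom ι Δ τ U hU hα = heckeRepHom ι Δ τ U hU hγ := by
  subst hαβ
  refine Rep.hom_ext (Representation.IntertwiningMap.ext (LinearMap.ext fun f => ?_))
  change (heckeRepHom ι Δ τ U hU hα).hom ((heckeRepHom ι Δ τ U hU hβ).hom f) = _
  refine Subtype.ext ?_
  rw [heckeRepHom_hom_apply_coe, heckeRepHom_hom_apply_coe]
  exact heckeOp_heckeOp_apply hU hα hβ hfin hfin' hfin'' hmul hinj f.2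

/-- **`T(α) T(β) = T(γ)` on `H^i(U, τ)`** (`γ = αβ`; criterion `heckeOp_heckeOp_apply`).
[cite: ShimuraIATAF1971, Ch. 3, Prop. 3.3] -/
theorem heckeCohomology_mul_eq {α β γ : 𝒢} (hα : α ∈ Δ) (hβ : β ∈ Δ) (hγ : γ ∈ Δ) (hαβ : α * β = γ)
    (hfin : (ArithmeticQuotient.doubleCosetQuot U α).Finite)
    (hfin' : (ArithmeticQuotient.doubleCosetQuot U β).Finite)
    (hfin'' : (ArithmeticQuotient.doubleCosetQuot U (α * β)).Finite)
    (hmul : ∀ l ∈ U, ((α * l * β : 𝒢) : 𝒢 ⧸ U) ∈ ArithmeticQuotient.doubleCosetQuot U (α * β))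
    (hinj : ∀ y y' : 𝒢, (y : 𝒢 ⧸ U) ∈ ArithmeticQuotient.doubleCosetQuot U α →
      (y' : 𝒢 ⧸ U) ∈ ArithmeticQuotient.doubleCosetQuot U α →
      ∀ e ∈ ArithmeticQuotient.doubleCosetQuot U β, ∀ e' ∈ ArithmeticQuotient.doubleCosetQuot U β,
        y • e = y' • e' → (y : 𝒢 ⧸ U) = (y' : 𝒢 ⧸ U)) (i : ℕ) :
    heckeCohomology ι Δ τ U hU hα i * heckeCohomology ι Δ τ U hU hβ i = heckeCohomology ι Δ τ U hU hγ i := by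
  have hrep := heckeRepHom_comp_heckeRepHom ι Δ τ U hU hα hβ hγ hαβ hfin hfin' hfin'' hmul hinj
  dsimp only [heckeCohomology]
  rw [← hrep, groupCohomology.map_id_comp, Module.End.mul_eq_comp, ModuleCat.hom_comp]

/-- Transport of `heckeCohomology` along an equality of elements. [folklore] -/
theorem heckeCohomology_congr {α β : 𝒢} (hα : α ∈ Δ) (hβ : β ∈ Δ) (h : α = β) (i : ℕ) :
    heckeCohomology ι Δ τ U hU hα i = heckeCohomology ι Δ τ U hU hβ i := by
  subst h
  rfl

end Cohomology

/-! ### The Hida levels `U(b',c)`: `U_p`-operators multiply -/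

section Level

open BigHeckeGLn

variable {K : Type} [Field K] [NumberField K] {p : ℕ} [Fact p.Prime] {𝒰 : TameLevel 2 K p}
  {R : Type} [CommRing R] {Γ : Type} [Group Γ] (ι : Γ →* FiniteAdelicGL 2 K)
  (Δ : Submonoid (FiniteAdelicGL 2 K)) {V : Type} [AddCommGroup V] [Module R V]
  (τ : Δ →* Module.End R V)

/-- **`T(t_v^a) T(t_v^b) = T(t_v^{a+b})` on `H^i(U(b',c), τ)`** for `v ∣ p`, `a + b ≤ c`
(`U` maximal above `p`). [cite: ShimuraIATAF1971, Ch. 3, Prop. 3.3] [cite: Hida1994AIF, §2] -/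
theorem heckeCohomology_level_heckeElement_pow_mul (h𝒰 : 𝒰.IsMaximalAbove) {v : HeightOneSpectrum (𝓞 K)}
    (hv : (p : 𝓞 K) ∈ v.asIdeal) {b' c a b : ℕ} (hab : a + b ≤ c)
    (hU : (𝒰.level b' c).toSubmonoid ≤ Δ) (ht : heckeElement 2 K v 1 ∈ Δ) (i : ℕ) :
    heckeCohomology ι Δ τ (𝒰.level b' c) hU (pow_mem ht a) i *
        heckeCohomology ι Δ τ (𝒰.level b' c) hU (pow_mem ht b) i =
      heckeCohomology ι Δ τ (𝒰.level b' c) hU (pow_mem ht (a + b)) i :=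
  heckeCohomology_mul_eq ι Δ τ (𝒰.level b' c) hU (pow_mem ht a) (pow_mem ht b) (pow_mem ht (a + b))
    (pow_add _ a b).symm (finite_orbit_quotient (𝒰.level b' c) _) (finite_orbit_quotient (𝒰.level b' c) _)
    (finite_orbit_quotient (𝒰.level b' c) _)
    (fun l hl => 𝒰.heckeElement_pow_mul_mul_mem_doubleCosetQuot h𝒰 hv (by omega) l hl)
    (fun y y' hy hy' e he e' he' hee => 𝒰.coe_eq_coe_of_smul_eq_smul h𝒰 hv hab y y' hy hy' e he e' he' hee) i

/-- **`T(t_v^r) = T(t_v)^r` on `H^i(U(b',c), τ)`** for `v ∣ p`, `r ≤ c`. [folklore] -/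
theorem heckeCohomology_level_heckeElement_pow (h𝒰 : 𝒰.IsMaximalAbove) {v : HeightOneSpectrum (𝓞 K)}
    (hv : (p : 𝓞 K) ∈ v.asIdeal) {b' c r : ℕ} (hr : r ≤ c)
    (hU : (𝒰.level b' c).toSubmonoid ≤ Δ) (ht : heckeElement 2 K v 1 ∈ Δ) (i : ℕ) :
    heckeCohomology ι Δ τ (𝒰.level b' c) hU (pow_mem ht r) i =
      heckeCohomology ι Δ τ (𝒰.level b' c) hU ht i ^ r := by
  induction r with
  | zero =>
    rw [pow_zero (heckeCohomology ι Δ τ (𝒰.level b' c) hU ht i)]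
    have h1 : heckeElement 2 K v 1 ^ 0 ∈ 𝒰.level b' c := by rw [pow_zero]; exact one_mem _
    exact heckeCohomology_of_mem_level ι Δ τ (𝒰.level b' c) hU h1 i
  | succ r ih =>
    rw [pow_succ (heckeCohomology ι Δ τ (𝒰.level b' c) hU ht i) r, ← ih (by omega),
      ← heckeCohomology_congr ι Δ τ (𝒰.level b' c) hU (pow_mem ht 1) ht (pow_one _) i,
      heckeCohomology_level_heckeElement_pow_mul ι Δ τ h𝒰 hv (show r + 1 ≤ c from hr) hU ht i]

/-- **`T(g) T(t_w^b) = T(g t_w^b)` on `H^i(U(b',c), τ)`** for `w ∣ p`, `b ≤ c` and `g ∈ Δ` with trivial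
`w`-component. [cite: ShimuraIATAF1971, Ch. 3, Prop. 3.3] [cite: KhareThorne2017, §6.4] -/
theorem heckeCohomology_level_mul_heckeElement_pow (h𝒰 : 𝒰.IsMaximalAbove) {w : HeightOneSpectrum (𝓞 K)}
    (hw : (p : 𝓞 K) ∈ w.asIdeal) {b' c b : ℕ} (hb : b ≤ c) {g : FiniteAdelicGL 2 K}
    (hg : localComponent 2 K w g = 1) (hU : (𝒰.level b' c).toSubmonoid ≤ Δ) (hgΔ : g ∈ Δ)
    (ht : heckeElement 2 K w 1 ∈ Δ) (i : ℕ) :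
    heckeCohomology ι Δ τ (𝒰.level b' c) hU hgΔ i * heckeCohomology ι Δ τ (𝒰.level b' c) hU (pow_mem ht b) i =
      heckeCohomology ι Δ τ (𝒰.level b' c) hU (Δ.mul_mem hgΔ (pow_mem ht b)) i :=
  heckeCohomology_mul_eq ι Δ τ (𝒰.level b' c) hU hgΔ (pow_mem ht b) (Δ.mul_mem hgΔ (pow_mem ht b)) rfl
    (finite_orbit_quotient (𝒰.level b' c) _) (finite_orbit_quotient (𝒰.level b' c) _)
    (finite_orbit_quotient (𝒰.level b' c) _)
    (fun l hl => 𝒰.mul_mul_heckeElement_pow_mem_doubleCosetQuot h𝒰 hw hb hg l hl)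
    (fun y y' hy hy' e he e' he' hee =>
      𝒰.coe_eq_coe_of_smul_eq_smul_of_localComponent_eq_one h𝒰 hw hb hg y y' hy hy' e he e' he' hee) i

omit [Fact p.Prime] in
/-- `∏_{v ∈ s} t_v^r ∈ Δ` when all `t_{v,1} ∈ Δ`. [folklore] -/
theorem upElement_mem_of_forall (hΔ : ∀ v : HeightOneSpectrum (𝓞 K), heckeElement 2 K v 1 ∈ Δ)
    (s : Finset (HeightOneSpectrum (𝓞 K))) (r : ℕ) : TameLevel.upElement (K := K) s r ∈ Δ :=
  Submonoid.noncommProd_mem _ _ _ _ fun v _ => pow_mem (hΔ v) r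

open scoped Classical in
/-- **`T(∏_{v ∈ s ∪ {w}} t_v^r) = T(∏_{v ∈ s} t_v^r) · T(t_w)^r` on `H^i(U(b',c), τ)`** for `w ∣ p`,
`w ∉ s`, `r ≤ c`: the `U_p`-operators at the places above `p` multiply.
[cite: ShimuraIATAF1971, Ch. 3, Prop. 3.3] [cite: KhareThorne2017, §6.2, §6.4] -/
theorem heckeCohomology_level_upElement_insert (h𝒰 : 𝒰.IsMaximalAbove) {b' c r : ℕ} (hr : r ≤ c)
    {s : Finset (HeightOneSpectrum (𝓞 K))} {w : HeightOneSpectrum (𝓞 K)} (hws : w ∉ s)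
    (hw : (p : 𝓞 K) ∈ w.asIdeal) (hU : (𝒰.level b' c).toSubmonoid ≤ Δ)
    (hΔ : ∀ v : HeightOneSpectrum (𝓞 K), heckeElement 2 K v 1 ∈ Δ) (i : ℕ) :
    heckeCohomology ι Δ τ (𝒰.level b' c) hU (upElement_mem_of_forall Δ hΔ (insert w s) r) i =
      heckeCohomology ι Δ τ (𝒰.level b' c) hU (upElement_mem_of_forall Δ hΔ s r) i *
        heckeCohomology ι Δ τ (𝒰.level b' c) hU (hΔ w) i ^ r := by
  have hup : TameLevel.upElement (insert w s) r = TameLevel.upElement s r * heckeElement 2 K w 1 ^ r := by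
    rw [TameLevel.upElement, Finset.noncommProd_insert_of_notMem _ _ _ _ hws, TameLevel.upElement]
    exact (Finset.noncommProd_commute s _ _ _ fun v _ => commute_heckeElement_pow w v r r).eq
  rw [heckeCohomology_congr ι Δ τ (𝒰.level b' c) hU (upElement_mem_of_forall Δ hΔ (insert w s) r)
      (Δ.mul_mem (upElement_mem_of_forall Δ hΔ s r) (pow_mem (hΔ w) r)) hup i,
    ← heckeCohomology_level_mul_heckeElement_pow ι Δ τ h𝒰 hw hr
      (TameLevel.localComponent_upElement_of_not_mem hws) hU (upElement_mem_of_forall Δ hΔ s r) (hΔ w) i,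
    heckeCohomology_level_heckeElement_pow ι Δ τ h𝒰 hw hr hU (hΔ w) i]

end Level

end Literature.NumberTheory.Automorphic.LevelAction
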